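import Summits.CriticalPhenomena.PercolationContinuityZ3.Theorems.Transplant.SkelPhiParaRunFrame
import HarnessLib

/-!
# N1 (the `{±1}` node), LEVEL 1: the COLUMN DEVICE of the run frames — under (ι) `Steps` of `φ`, every point of the run plane `(σα, ⌊σβ′/(n+|h|)⌋)` (resp.
# the y′-frame) is the image `runX φ c₀ n h σ g` of a vertex `g` within an explicit graph distance of the run origin — the `exists_mem_graphBall_φ_eq`
# of the run frames (they have no unit steps of their own: the transverse coordinate is floored), used to show that run-window cores are nonempty

builds on p205010 (kernel theorem, internal audit signed; external expert review pending) — nothing in this file uses p205010; nothing here is a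
claim about the open node `SamePDropOfSkeletonNeg`.
Lane `prim-bschramm`, seat `prim-bschramm-p1` (gen 11; NEG-SCOPE v1.1 §5 / P5-R2, hp-8 NEG-NODE-F-SCOPE §12 (s1)/(s5): two-map devices); helper file
(`--supports stmt-CriticalPhenomena-4575 --as helper`).
* §1 `exists_mul_mem_Icc` (an arithmetic progression of step `n ≤ c` meets every window of length `c`: `e := −((−T)/n)` has `T ≤ n·e ≤ T + n − 1`);
* §2 **`exists_mem_graphBall_runX_eq`**, **`exists_mem_graphBall_runY_eq`** (from `Steps G φ`, `1 ≤ n`, `σ = ±1`: a vertex over every run-plane point, within graph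
  distance `|y₀| + (c·|y₁| + |h|·|y₀|)/n + 1` of the origin for the x-frame, coordinates exchanged for the y′-frame).
[cite: KozmaNitzan2024, §4 p. 26 ((29): the column of x inside Q_x)] [cite: MartineauTassion2017, §4.3]
-/

noncomputable section

namespace Summit.CriticalPhenomena.PercolationContinuityZ3.Theorems.Transplant

namespace Skelφ

open Literature.Probability.Percolation Literature.Probability.LatticeModels SimpleGraph
open Literature.Barriers.CriticalPhenomena (graphBall graphBall_mono)

variable {V : Type} {G : SimpleGraph V} {φ : V → Site 2}

/-! ## §1 Arithmetic progressions meet windows -/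

/-- **Ceiling by floor**: for `0 < n`, `e := −((−T)/n)` satisfies `T ≤ n·e ≤ T + n − 1` and `|e| ≤ |T|/n + 1`. [folklore] -/
theorem exists_mul_mem_Icc {n : ℤ} (hn : 0 < n) (T : ℤ) : ∃ e : ℤ, T ≤ n * e ∧ n * e ≤ T + n - 1 ∧ |e| ≤ |T| / n + 1 := by
  refine ⟨-((-T) / n), ?_, ?_, ?_⟩
  · have h1 := Int.mul_ediv_add_emod (-T) n
    have h2 := Int.emod_nonneg (-T) hn.ne'
    linarith
  · have h1 := Int.mul_ediv_add_emod (-T) n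
    have h2 := Int.emod_lt_of_pos (-T) hn
    linarith
  · -- `|−((−T)/n)| ≤ |T|/n + 1`
    rw [abs_neg, abs_le]
    have hT := abs_le.1 (le_refl |T|)
    constructor
    · -- `−(|T|/n + 1) ≤ (−T)/n` from `−|T| ≤ −T`... via monotonicity and `(−|T|)/n ≥ −(|T|/n) − 1`
      have h1 : (-|T|) / n ≤ (-T) / n := Int.ediv_le_ediv hn (by linarith [le_abs_self T])
      have h2 := ediv_sub_ediv_le_add_one (x := 0) (y := -|T|) (b := |T|) hn (by simp)
      rw [Int.zero_ediv, zero_sub] at h2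
      linarith
    · have h1 : (-T) / n ≤ |T| / n := Int.ediv_le_ediv hn (by linarith [neg_abs_le T])
      linarith

/-! ## §2 A vertex over every run-plane point -/

/-- **The column device of the x-frame**: under `Steps G φ` (`1 ≤ n`, `σ = ±1`), every run-plane point `y` is `runX φ c₀ n h σ g` for a vertex `g` within graph
distance `|y₀| + ((n+|h|)·|y₁| + |h|·|y₀| + (n+|h|))/n + 1` of the run origin `c₀`. [cite: KozmaNitzan2024, §4 p. 26 ((29))] -/
theorem exists_mem_graphBall_runX_eq (hstep : Steps G φ) {n : ℕ} (hn : 1 ≤ n) (c₀ : V) (h : ℤ) {σ : ℤ} (hσ : σ = 1 ∨ σ = -1) (y : Site 2) :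
    ∃ g, g ∈ graphBall G c₀ ((y 0).natAbs + (((shearUnit n h : ℤ) * |y 1| + |h| * |y 0| + shearUnit n h) / n).natAbs + 1) ∧
      runX φ c₀ n h σ g = y := by
  have hσσ : σ * σ = 1 := by rcases hσ with rfl | rfl <;> simp
  have hn0 : (0 : ℤ) < n := by exact_mod_cast hn
  have hc := shearUnit_pos hn h
  -- along: `a := σ y₀`; transverse target window `[c y₁ + h y₀, c y₁ + h y₀ + c − 1]` for `n e − h y₀ + h y₀`
  obtain ⟨e, he1, he2, he3⟩ := exists_mul_mem_Icc hn0 ((shearUnit n h : ℤ) * y 1 + h * y 0)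
  -- the vertex with `φ g = φ c₀ + (σ y₀, σ e)`
  obtain ⟨g, hg, hφ⟩ := exists_mem_graphBall_φ_eq hstep c₀ (fun i => if i = 0 then φ c₀ 0 + σ * y 0 else φ c₀ 1 + σ * e)
  have hz0 : (fun i : Fin 2 => if i = 0 then φ c₀ 0 + σ * y 0 else φ c₀ 1 + σ * e) 0 - φ c₀ 0 = σ * y 0 := by simp
  have hz1 : (fun i : Fin 2 => if i = 0 then φ c₀ 0 + σ * y 0 else φ c₀ 1 + σ * e) 1 - φ c₀ 1 = σ * e := by simp
  refine ⟨g, graphBall_mono G c₀ ?_ hg, ?_⟩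
  · -- the distance bound
    rw [hz0, hz1, Int.natAbs_mul, Int.natAbs_mul]
    have hσn : σ.natAbs = 1 := by rcases hσ with rfl | rfl <;> simp
    rw [hσn, one_mul, one_mul]
    have hTabs : |(shearUnit n h : ℤ) * y 1 + h * y 0| ≤ (shearUnit n h : ℤ) * |y 1| + |h| * |y 0| := by
      refine (abs_add_le _ _).trans ?_
      rw [abs_mul, abs_mul, abs_of_pos hc]
    have h1 : |(shearUnit n h : ℤ) * y 1 + h * y 0| / n ≤ ((shearUnit n h : ℤ) * |y 1| + |h| * |y 0| + shearUnit n h) / n :=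
      Int.ediv_le_ediv hn0 (by linarith)
    have h3 : (0 : ℤ) ≤ ((shearUnit n h : ℤ) * |y 1| + |h| * |y 0| + shearUnit n h) / n := Int.ediv_nonneg (by positivity) hn0.le
    have h4 : (e.natAbs : ℤ) ≤ (((shearUnit n h : ℤ) * |y 1| + |h| * |y 0| + shearUnit n h) / n).natAbs + 1 := by
      rw [Int.natCast_natAbs, Int.natCast_natAbs, abs_of_nonneg h3]; linarith
    have h5 : e.natAbs ≤ (((shearUnit n h : ℤ) * |y 1| + |h| * |y 0| + shearUnit n h) / n).natAbs + 1 := by exact_mod_cast h4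
    omega
  · -- the frame coordinates of `g`
    have hα : relCoord φ c₀ 0 g = σ * y 0 := by rw [relCoord_apply, hφ]; exact hz0
    have hβ' : σ * shearCoord φ c₀ n h g = n * e - h * y 0 := by
      have e0 : φ g 0 - φ c₀ 0 = σ * y 0 := by rw [hφ]; exact hz0
      have e1 : φ g 1 - φ c₀ 1 = σ * e := by rw [hφ]; exact hz1
      rw [shearCoord_apply, e0, e1]
      have : σ * ((n : ℤ) * (σ * e) - h * (σ * y 0)) = (σ * σ) * (n * e) - (σ * σ) * (h * y 0) := by ring
      rw [this, hσσ]; ring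
    funext i
    fin_cases i
    · show runX φ c₀ n h σ g 0 = y 0
      rw [runX_zero, hα, ← mul_assoc, hσσ, one_mul]
    · show runX φ c₀ n h σ g 1 = y 1
      rw [runX_one, hβ']
      apply TwoAxis.Para.ediv_eq_of_bounds hc
      · linarith
      · have : (n : ℤ) ≤ (shearUnit n h : ℤ) := by unfold shearUnit; push_cast; linarith [abs_nonneg h, Int.natCast_natAbs h]
        linarith

/-- **The column device of the y′-frame** (coordinates exchanged). [cite: KozmaNitzan2024, §4 p. 26 ((29))] -/
theorem exists_mem_graphBall_runY_eq (hstep : Steps G φ) {n : ℕ} (hn : 1 ≤ n) (c₀ : V) (h : ℤ) {σ : ℤ} (hσ : σ = 1 ∨ σ = -1) (y : Site 2) :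
    ∃ g, g ∈ graphBall G c₀ ((y 1).natAbs + (((shearUnit n h : ℤ) * |y 0| + |h| * |y 1| + shearUnit n h) / n).natAbs + 1) ∧
      runY φ c₀ n h σ g = y := by
  obtain ⟨g, hg, hrun⟩ := exists_mem_graphBall_runX_eq hstep hn c₀ h hσ (fun i => if i = 0 then y 1 else y 0)
  refine ⟨g, by simpa using hg, ?_⟩
  funext i
  fin_cases i
  · show runY φ c₀ n h σ g 0 = y 0
    have := congrFun hrun 1
    rw [runX_one] at this
    rw [runY_zero, this]; simp
  · show runY φ c₀ n h σ g 1 = y 1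
    have := congrFun hrun 0
    rw [runX_zero] at this
    rw [runY_one, this]; simp

end Skelφ

end Summit.CriticalPhenomena.PercolationContinuityZ3.Theorems.Transplant

end
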